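import Literature.NumberTheory.Automorphic.AdelicSchwartzBruhatLF
import Literature.NumberTheory.Weil1964.AdelicThetaWeylElement
import Literature.NumberTheory.Weil1964.AdelicSecondDegreeCharacter
import Literature.Analysis.Distribution.SchwartzFourierBilinFormCLM
import HarnessLib

/-!
# The operators `d(g)`, `t(S)`, `N`, `𝓕` of the adelic Schrödinger model are tensor products, hence LF-continuous

Construction file (everything proved; no property of print is asserted). The tree's operators of `𝒮(𝔸_F^ι)`

* `twistLM F g : Φ ↦ Φ(· g)`, `g ∈ GL_n(𝔸_F)` (`AdelicThetaDistribution`),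
* `chirpLM F S : Φ ↦ ψ_F(q_S) Φ`, `S ∈ M_n(𝔸_F)` (`AdelicSecondDegreeCharacter`),
* `negLM F ι : Φ ↦ Φ(-·)` and `fourierLM F ι ν : Φ ↦ Φ̂` (`AdelicThetaWeylElement`, `AdelicThetaDistribution`),

are identified with TENSOR PRODUCTS `A ⊗ B` (`adelicTensorEnd`) of a CONTINUOUS linear operator `A` of the Fréchet
space `𝓢((F ⊗ ℝ)^ι)` and a linear operator `B` of `𝒮((𝔸_F^∞)^ι)` along `𝒮(𝔸_F^ι) = 𝓢(X_∞) ⊗ 𝒮(X_f)`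
(`piSchwartzBruhatEquiv`):

* `twistLM_eq_adelicTensorEnd`: `d(g) = (φ ↦ φ(· g_∞)) ⊗ (Φ_f ↦ Φ_f(· g_f))`;
* `chirpLM_eq_adelicTensorEnd`: `t(S) = (𝐞(-q_{S_∞}) ·) ⊗ (ψ_f(q_{S_f}) ·)` (`sdChar_eq_mul`);
* `negLM_eq_adelicTensorEnd`: `N = N_∞ ⊗ N_f`;
* `fourierLM_eq_adelicTensorEnd`: `𝓕_ν = (c · 𝓕_∞) ⊗ 𝓕_f` for `ν = c · split_*(μ_∞ ⊗ μ_f)` (`adelicPiFourier_tensor`), with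
  `𝓕_∞ = SchwartzMap.bilinFourierCLM μ_∞ ⟨·,·⟩_Tr` Mathlib's Fourier transform of Schwartz functions transported to
  the trace pairing;

consequently (`isLFContinuous_adelicTensorEnd`) **all four are LF-continuous** (`isLFContinuous_twistLM`,
`isLFContinuous_chirpLM`, `isLFContinuous_negLM`, `isLFContinuous_fourierLM`), and the Fourier AUTOMORPHISM
`fourierEquiv` with its inverse lies in `lfUnits` (`fourierEquiv_mem_lfUnits`, `fourierEquiv_symm_mem_lfUnits`). These are
the continuity inputs for the implementers of the Siegel-parabolic generators and of the Weyl element in the metaplectic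
group of record `Mp_ψ(W_𝔸)ᶜᵒⁿᵗ` (sequel `AdelicMetaplecticGenerators`). [folklore]

## References

* A. Weil, *Sur certains groupes d'opérateurs unitaires*, Acta Math. 111 (1964), Chap. I n° 11–13 (the operators
  `d(α)`, `t(f)`, `d'(γ)` are automorphisms of the topological vector space `𝒮(X)`) [Weil1964].
* J. Tate, in Cassels–Fröhlich (eds.), *Algebraic Number Theory* (1967), Ch. XV §3.3, §4.2 [CasselsFrohlichANT1967].
-/

noncomputable section

open scoped BigOperators NNReal ENNReal Matrix SchwartzMap TensorProduct FourierTransform Classical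
open NumberField NumberField.mixedEmbedding IsDedekindDomain MeasureTheory MeasureTheory.Measure TensorProduct

namespace Literature.NumberTheory.Weil1964

open Literature.NumberTheory.Automorphic Literature.Analysis.Distribution

attribute [local instance] secondCountableTopology_adeleRing locallyCompactSpace_adeleRing'
  secondCountableTopology_finiteAdeleRing locallyCompactSpace_finiteAdeleRing'

/-! ## §1. Linear operators of the finite factor `𝒮((𝔸_F^∞)^ι)` -/

section Finite

variable {F : Type} [Field F] [NumberField F] {ι : Type}

/-- Precomposition with a homeomorphism of `(𝔸_F^∞)^ι` as a linear endomorphism of `𝒮((𝔸_F^∞)^ι)` (locally constant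
and compactly supported functions are stable). [folklore] -/
def finCompLM (e : (ι → FiniteAdeleRing (𝓞 F) F) ≃ₜ (ι → FiniteAdeleRing (𝓞 F) F)) : FinSB F ι →ₗ[ℂ] FinSB F ι where
  toFun Φ := ⟨(Φ : (ι → FiniteAdeleRing (𝓞 F) F) → ℂ) ∘ e, (mem_schwartzBruhat_iff).2
    ⟨((mem_schwartzBruhat_iff).1 Φ.2).1.comp_continuous e.continuous,
      ((mem_schwartzBruhat_iff).1 Φ.2).2.comp_homeomorph e⟩⟩
  map_add' _ _ := rfl
  map_smul' _ _ := rfl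

/-- Unfolding of `finCompLM`. [folklore] -/
@[simp] theorem coe_finCompLM (e : (ι → FiniteAdeleRing (𝓞 F) F) ≃ₜ (ι → FiniteAdeleRing (𝓞 F) F)) (Φ : FinSB F ι) :
    ((finCompLM e Φ : FinSB F ι) : (ι → FiniteAdeleRing (𝓞 F) F) → ℂ) =
      (Φ : (ι → FiniteAdeleRing (𝓞 F) F) → ℂ) ∘ e := rfl

/-- Multiplication by a locally constant function as a linear endomorphism of `𝒮((𝔸_F^∞)^ι)`. [folklore] -/
def finMulLM (c : (ι → FiniteAdeleRing (𝓞 F) F) → ℂ) (hc : IsLocallyConstant c) : FinSB F ι →ₗ[ℂ] FinSB F ι where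
  toFun Φ := ⟨fun b => c b * (Φ : (ι → FiniteAdeleRing (𝓞 F) F) → ℂ) b, (mem_schwartzBruhat_iff).2
    ⟨hc.mul ((mem_schwartzBruhat_iff).1 Φ.2).1, ((mem_schwartzBruhat_iff).1 Φ.2).2.mul_left⟩⟩
  map_add' Φ Ψ := by
    apply Subtype.ext
    funext b
    simp only [Submodule.coe_add, Pi.add_apply, mul_add]
  map_smul' a Φ := by
    apply Subtype.ext
    funext b
    simp only [Submodule.coe_smul, Pi.smul_apply, smul_eq_mul, RingHom.id_apply]
    ring

/-- Unfolding of `finMulLM`. [folklore] -/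
@[simp] theorem coe_finMulLM (c : (ι → FiniteAdeleRing (𝓞 F) F) → ℂ) (hc : IsLocallyConstant c) (Φ : FinSB F ι) :
    ((finMulLM c hc Φ : FinSB F ι) : (ι → FiniteAdeleRing (𝓞 F) F) → ℂ) =
      fun b => c b * (Φ : (ι → FiniteAdeleRing (𝓞 F) F) → ℂ) b := rfl

variable [Fintype ι] [MeasurableSpace (FiniteAdeleRing (𝓞 F) F)] [BorelSpace (FiniteAdeleRing (𝓞 F) F)]
  (μf : Measure (ι → FiniteAdeleRing (𝓞 F) F)) [μf.IsAddHaarMeasure]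

/-- The finite-adelic Fourier transform `finitePiFourier` as a linear endomorphism of `𝒮((𝔸_F^∞)^ι)`
(`finitePiFourier_mem_schwartzBruhat`). [cite: CasselsFrohlichANT1967, Ch. XV (Tate), §3.2] -/
def finFourierLM : FinSB F ι →ₗ[ℂ] FinSB F ι where
  toFun Φ := ⟨finitePiFourier F μf (Φ : (ι → FiniteAdeleRing (𝓞 F) F) → ℂ),
    finitePiFourier_mem_schwartzBruhat F μf Φ.2⟩
  map_add' Φ Ψ := by
    apply Subtype.ext
    funext η
    simp only [Submodule.coe_add, Pi.add_apply]
    exact finitePiFourier_add F μf (integrable_of_mem_schwartzBruhat F μf Φ.2)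
      (integrable_of_mem_schwartzBruhat F μf Ψ.2) η
  map_smul' a Φ := by
    apply Subtype.ext
    funext η
    simp only [Submodule.coe_smul, Pi.smul_apply, smul_eq_mul, RingHom.id_apply]
    exact finitePiFourier_smul F μf a _ η

/-- Unfolding of `finFourierLM`. [folklore] -/
@[simp] theorem coe_finFourierLM (Φ : FinSB F ι) :
    ((finFourierLM μf Φ : FinSB F ι) : (ι → FiniteAdeleRing (𝓞 F) F) → ℂ) =
      finitePiFourier F μf (Φ : (ι → FiniteAdeleRing (𝓞 F) F) → ℂ) := rfl

end Finite

/-! ## §2. `d(g)` and `t(S)` are tensor products -/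

section TwistChirp

variable (F : Type) [Field F] [NumberField F] {n : ℕ}

/-- **`d(g) = d(g_∞) ⊗ d(g_f)`**: `twistLM F g` is the tensor product of precomposition with `y ↦ y g_∞` on `𝓢((F ⊗ ℝ)ⁿ)`
(Mathlib `SchwartzMap.compCLMOfContinuousLinearEquiv`) and precomposition with `y ↦ y g_f` on `𝒮((𝔸_F^∞)ⁿ)`.
[folklore] -/
theorem twistLM_eq_adelicTensorEnd (g : GL (Fin n) (AdeleRing (𝓞 F) F)) :
    twistLM F g = adelicTensorEnd
      ((SchwartzMap.compCLMOfContinuousLinearEquiv ℂ (vecArchCLE n F (GLn.archUnit n F g)) :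
        𝓢((Fin n → mixedSpace F), ℂ) →L[ℂ] 𝓢((Fin n → mixedSpace F), ℂ)) :
        𝓢((Fin n → mixedSpace F), ℂ) →ₗ[ℂ] 𝓢((Fin n → mixedSpace F), ℂ))
      (finCompLM (vecFinHomeomorph (GLn.finUnit n F g))) := by
  refine linearMap_ext_tensor fun Φinf Φfin => ?_
  rw [adelicTensorEnd_apply_tmul]
  apply Subtype.ext
  rw [coe_twistLM, coe_piSchwartzBruhatEquiv_tmul, coe_piSchwartzBruhatEquiv_tmul]
  funext x
  simp only [twist_apply, piArch_vecMul, piFinite_vecMul, ContinuousLinearMap.coe_coe,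
    SchwartzMap.compCLMOfContinuousLinearEquiv_apply, Function.comp_apply, vecArchCLE_apply, GLn.coe_archUnit,
    coe_finCompLM]
  rfl

/-- hence **`d(g)` is LF-continuous**. [cite: Weil1964, Chap. I n° 11–13] -/
theorem isLFContinuous_twistLM (g : GL (Fin n) (AdeleRing (𝓞 F) F)) : IsLFContinuous (twistLM F g) := by
  rw [twistLM_eq_adelicTensorEnd]
  exact isLFContinuous_adelicTensorEnd _ _

/-- **`t(S) = t(S_∞) ⊗ t(S_f)`**: `chirpLM F S` is the tensor product of the multiplication by the archimedean
second-degree character `𝐞(-q_{S_∞})` on `𝓢((F ⊗ ℝ)ⁿ)` (`archSdCharCLM`, Mathlib `SchwartzMap.smulLeftCLM`) and by the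
locally constant `ψ_f(q_{S_f})` on `𝒮((𝔸_F^∞)ⁿ)` (`sdChar_eq_mul`). [folklore] -/
theorem chirpLM_eq_adelicTensorEnd (S : Matrix (Fin n) (Fin n) (AdeleRing (𝓞 F) F)) :
    chirpLM F S = adelicTensorEnd
      (archSdCharCLM F (S.map (archHom F)) : 𝓢((Fin n → mixedSpace F), ℂ) →ₗ[ℂ] 𝓢((Fin n → mixedSpace F), ℂ))
      (finMulLM (finSdChar (S.map (RingHom.snd (InfiniteAdeleRing F) (FiniteAdeleRing (𝓞 F) F))))
        (isLocallyConstant_finSdChar _)) := by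
  refine linearMap_ext_tensor fun Φinf Φfin => ?_
  rw [adelicTensorEnd_apply_tmul]
  apply Subtype.ext
  rw [coe_chirpLM, coe_piSchwartzBruhatEquiv_tmul, coe_piSchwartzBruhatEquiv_tmul]
  funext x
  simp only [chirp_apply, ContinuousLinearMap.coe_coe, archSdCharCLM_apply, coe_finMulLM]
  rw [sdChar_eq_mul]
  ring

/-- hence **`t(S)` is LF-continuous**. [cite: Weil1964, Chap. I n° 11–13] -/
theorem isLFContinuous_chirpLM (S : Matrix (Fin n) (Fin n) (AdeleRing (𝓞 F) F)) : IsLFContinuous (chirpLM F S) := by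
  rw [chirpLM_eq_adelicTensorEnd]
  exact isLFContinuous_adelicTensorEnd _ _

end TwistChirp

/-! ## §3. `N` and `𝓕` are tensor products -/

section Fourier

variable (F : Type) [Field F] [NumberField F] (ι : Type) [Fintype ι]

/-- **`N = N_∞ ⊗ N_f`**. [folklore] -/
theorem negLM_eq_adelicTensorEnd :
    negLM F ι = adelicTensorEnd
      ((SchwartzMap.compCLMOfContinuousLinearEquiv ℂ
          (ContinuousLinearEquiv.neg ℝ : (ι → mixedSpace F) ≃L[ℝ] (ι → mixedSpace F)) :
        𝓢((ι → mixedSpace F), ℂ) →L[ℂ] 𝓢((ι → mixedSpace F), ℂ)) :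
        𝓢((ι → mixedSpace F), ℂ) →ₗ[ℂ] 𝓢((ι → mixedSpace F), ℂ))
      (finCompLM (Homeomorph.neg (ι → FiniteAdeleRing (𝓞 F) F))) := by
  refine linearMap_ext_tensor fun Φinf Φfin => ?_
  rw [adelicTensorEnd_apply_tmul]
  apply Subtype.ext
  rw [coe_negLM, coe_piSchwartzBruhatEquiv_tmul, coe_piSchwartzBruhatEquiv_tmul]
  funext x
  simp only [piArch_neg, piFinite_neg, ContinuousLinearMap.coe_coe, SchwartzMap.compCLMOfContinuousLinearEquiv_apply,
    Function.comp_apply, ContinuousLinearEquiv.neg_apply, coe_finCompLM]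
  rfl

/-- hence **`N` is LF-continuous**. [folklore] -/
theorem isLFContinuous_negLM : IsLFContinuous (negLM F ι) := by
  rw [negLM_eq_adelicTensorEnd]
  exact isLFContinuous_adelicTensorEnd _ _

variable [MeasurableSpace (AdeleRing (𝓞 F) F)] [BorelSpace (AdeleRing (𝓞 F) F)]
  (ν : Measure (ι → AdeleRing (𝓞 F) F)) [ν.IsAddHaarMeasure]

/-- **`𝓕_ν = (c · 𝓕_∞) ⊗ 𝓕_f`** for `ν = c · split_*(μ_∞ ⊗ μ_f)`: the adelic Fourier transform of `𝒮(𝔸_F^ι)` is the tensor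
product of (a multiple of) the Fourier transform of `𝓢((F ⊗ ℝ)^ι)` for the trace pairing (`SchwartzMap.bilinFourierCLM`,
Mathlib's `SchwartzMap.fourierTransformCLM` transported) and the finite-adelic Fourier transform (`adelicPiFourier_tensor`;
the instance binder `[BorelSpace ((F ⊗ ℝ)^ι)]` is supplied by `Pi.borelSpace` at use). [cite: CasselsFrohlichANT1967, Ch. XV (Tate), §3.3, §4.2] -/
theorem fourierLM_eq_adelicTensorEnd [MeasurableSpace (FiniteAdeleRing (𝓞 F) F)] [BorelSpace (FiniteAdeleRing (𝓞 F) F)]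
    [BorelSpace (ι → mixedSpace F)] {μE : Measure (ι → mixedSpace F)} [μE.IsAddHaarMeasure] {μf : Measure (ι → FiniteAdeleRing (𝓞 F) F)}
    [μf.IsAddHaarMeasure] {c : ℝ≥0} (hν : ν = c • (μE.prod μf).map (piAdeleSplit F ι)) :
    fourierLM F ι ν = adelicTensorEnd
      (((c : ℂ) • SchwartzMap.bilinFourierCLM μE (piTracePairing F ι) (piTracePairing_nondegenerate F ι) :
          𝓢((ι → mixedSpace F), ℂ) →L[ℂ] 𝓢((ι → mixedSpace F), ℂ)) :
        𝓢((ι → mixedSpace F), ℂ) →ₗ[ℂ] 𝓢((ι → mixedSpace F), ℂ))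
      (finFourierLM μf) := by
  haveI : BorelSpace (ι → FiniteAdeleRing (𝓞 F) F) := Pi.borelSpace
  refine linearMap_ext_tensor fun Φinf Φfin => ?_
  rw [adelicTensorEnd_apply_tmul]
  apply Subtype.ext
  rw [coe_fourierLM, coe_piSchwartzBruhatEquiv_tmul, coe_piSchwartzBruhatEquiv_tmul]
  funext η
  rw [adelicPiFourier_tensor F ι ν Φinf _ hν η]
  simp only [ContinuousLinearMap.coe_coe, _root_.smul_apply, smul_eq_mul,
    SchwartzMap.bilinFourierCLM_apply, coe_finFourierLM]

variable {F ι ν}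

/-- hence **`𝓕_ν` is LF-continuous** (choose Haar measures on the two factors; `exists_haar_eq_smul_map_prod`).
[cite: Weil1964, Chap. I n° 13] -/
theorem isLFContinuous_fourierLM : IsLFContinuous (fourierLM F ι ν) := by
  letI : MeasurableSpace (FiniteAdeleRing (𝓞 F) F) := borel _
  haveI : BorelSpace (FiniteAdeleRing (𝓞 F) F) := ⟨rfl⟩
  haveI : BorelSpace (ι → FiniteAdeleRing (𝓞 F) F) := Pi.borelSpace
  haveI : BorelSpace (ι → mixedSpace F) := Pi.borelSpace
  obtain ⟨c, -, hν⟩ := exists_haar_eq_smul_map_prod F ι ν (addHaar : Measure (ι → mixedSpace F))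
    (addHaar : Measure (ι → FiniteAdeleRing (𝓞 F) F))
  rw [fourierLM_eq_adelicTensorEnd F ι ν hν]
  exact isLFContinuous_adelicTensorEnd _ _

/-- **The Fourier automorphism `fourierEquiv` (self-dual normalisation) lies in `lfUnits`**: it and its inverse
`𝓕 ∘ N` are LF-continuous. [cite: Weil1964, Chap. I n° 13] -/
theorem fourierEquiv_mem_lfUnits (hν : ν (piFundamentalDomain F ι) = 1) : fourierEquiv F ι ν hν ∈ lfUnits F ι :=
  ⟨isLFContinuous_fourierLM.congr fun _ => rfl,
    (isLFContinuous_fourierLM.comp (isLFContinuous_negLM F ι)).congr fun _ => rfl⟩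

/-- and so does its inverse `(fourierEquiv)⁻¹ = 𝓕 ∘ N`. [cite: Weil1964, Chap. I n° 13] -/
theorem fourierEquiv_symm_mem_lfUnits (hν : ν (piFundamentalDomain F ι) = 1) :
    (fourierEquiv F ι ν hν).symm ∈ lfUnits F ι :=
  ⟨(fourierEquiv_mem_lfUnits hν).2, (fourierEquiv_mem_lfUnits hν).1.congr fun _ => rfl⟩

/-- Underlying function of `(fourierEquiv)⁻¹ Φ`: `u ↦ Φ̂(-u)`. [folklore] -/
theorem coe_fourierEquiv_symm (hν : ν (piFundamentalDomain F ι) = 1) (Φ : piSchwartzBruhat F ι) :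
    (((fourierEquiv F ι ν hν).symm Φ : piSchwartzBruhat F ι) : (ι → AdeleRing (𝓞 F) F) → ℂ) =
      fun u => adelicPiFourier F ι ν (Φ : (ι → AdeleRing (𝓞 F) F) → ℂ) (-u) := by
  change ((fourierLM F ι ν (negLM F ι Φ) : piSchwartzBruhat F ι) : (ι → AdeleRing (𝓞 F) F) → ℂ) = _
  rw [coe_fourierLM, coe_negLM]
  exact adelicPiFourier_comp_neg_of_measure_eq_one hν Φ.2

end Fourier

end Literature.NumberTheory.Weil1964

end
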